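import Literature.Geometry.Lorentzian.CarterThresholdRate
import Literature.Geometry.Lorentzian.CarterSliverCapCoefficient
import HarnessLib

/-!
# Carter's coefficient just off the superradiant threshold: the threshold profile with a fuzz
# `E* = S²/ζ² + 2|Sω|(1 + (r₊ + r₋)/ζ)` on the far zone `r ≥ r₊ + ζ`
(namespace `Literature.Geometry.Lorentzian.Kerr`.)

Carter's radial equation (DRSR arXiv:1402.7034 §5.2.3), `V = Kerr.sepPotential M a ω m Λ`,
`σ := ω − mω₊`, `S := (r₊² + a²)σ`, `Λ′ = Λ − 2amω`, `J(r) = Λ′ − ω²(r + r₊)²(r − r₊)/(r − r₋)` the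
threshold profile of `CarterThresholdRate`. Off the threshold the exact profile acquires the term
`E(r) = S² + 2Sω(r − r₊)(r + r₊)` (`K = S + ω(r − r₊)(r + r₊)`):

* `sq_mul_negCoeff_eq_of_layer` — `(r² + a²)²(V(r) − ω²) = Δ·J(r) + (r² + a²)²V₁(r) − E(r)`
  (`r > r₊`, `|a| < M`);
* `sq_mul_negCoeff_mem_Icc_of_layer` — for `0 < ζ` and `r ≥ r₊ + ζ`:
  `Δ(J − E*) ≤ (r² + a²)²(V − ω²) ≤ Δ(J + 3 + E*)` with the `r`-independent fuzz
  `E* = S²/ζ² + 2|S||ω|(1 + (r₊ + r₋)/ζ)` (`|E| ≤ Δ·E*` since `Δ ≥ ζ(r − r₋)`,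
  `(r + r₊)/(r − r₋) ≤ 1 + (r₊ + r₋)/ζ`).

In the threshold SLIVER `|σ| ≤ 2ξ₁κ` one has `|S| ≤ ξ₁(r₊ − r₋)`, so `E*` is `O(ξ₁κ|ω|M²/θ₁)` on the
far zone `ζ = θ₁M/8`: negligible against `J ∼ Λ′` and against its slope `∼ ω²r₊` over κ-free lengths,
which is all the turning-point analysis (`CarterLayerTurningPoint`) uses. Near-extremal Kerr programme,
crux `KappaExplicitWaveDecay` (BF-stable large-`Λ` kernel bound, sliver case).

## References
* M. Dafermos, I. Rodnianski, Y. Shlapentokh-Rothman, arXiv:1402.7034 = Ann. of Math. 183 (2016),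
  §§5.2.3, 6.2 (key `DafermosRodnianskiShlapentokhrothman2014`). The algebra is folklore.
-/

noncomputable section

open Set

namespace Literature.Geometry.Lorentzian

namespace Kerr

section LayerRate

variable {M a ω Λ : ℝ} {m : ℤ}

/-- **Exact profile of Carter's coefficient off the threshold**: for `|a| < M`, `r > r₊`, with
`S = (r₊² + a²)(ω − mω₊)`:
`(r² + a²)²(V(r) − ω²) = Δ(r)·J(r) + (r² + a²)²V₁(r) − (S² + 2Sω(r − r₊)(r + r₊))`. [folklore] -/
theorem sq_mul_negCoeff_eq_of_layer (ha : |a| < M) {r : ℝ} (hr : rPlus M a < r) :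
    (r ^ 2 + a ^ 2) ^ 2 * (sepPotential M a ω m Λ r - ω ^ 2) =
      delta M a r *
          (Λ - 2 * a * m * ω - ω ^ 2 * (r + rPlus M a) ^ 2 * ((r - rPlus M a) / (r - rMinus M a))) +
        (r ^ 2 + a ^ 2) ^ 2 * sepPotential₁ M a r -
        (((rPlus M a ^ 2 + a ^ 2) * (ω - m * horizonAngularVelocity M a)) ^ 2 +
          2 * ((rPlus M a ^ 2 + a ^ 2) * (ω - m * horizonAngularVelocity M a)) *
            (ω * (r - rPlus M a) * (r + rPlus M a))) := by
  have hM : 0 < M := lt_of_le_of_lt (abs_nonneg a) ha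
  have hrp : 0 < rPlus M a := rPlus_pos hM a
  have hr0 : 0 < r := hrp.trans hr
  have hA : r ^ 2 + a ^ 2 ≠ 0 := by positivity
  have hsub : IsSubextremal M a := ha
  have hrm : 0 < r - rMinus M a := by linarith [hsub.rMinus_lt_rPlus]
  have h := sq_mul_coeff_eq M a ω m Λ hA
  have hK := radialK_eq_horizon_add hM ha.le ω m r
  have hΔ : delta M a r = (r - rPlus M a) * (r - rMinus M a) := delta_eq_mul ha.le r
  set S := (rPlus M a ^ 2 + a ^ 2) * (ω - m * horizonAngularVelocity M a) with hS
  have hK2 : radialK a ω m r ^ 2 =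
      delta M a r * (ω ^ 2 * (r + rPlus M a) ^ 2 * ((r - rPlus M a) / (r - rMinus M a))) +
        (S ^ 2 + 2 * S * (ω * (r - rPlus M a) * (r + rPlus M a))) := by
    rw [hK, hΔ]; field_simp; ring
  linear_combination -h - hK2

/-- **Two-sided bounds with fuzz on the far zone**: for `|a| < M`, `0 < ζ`, `r ≥ r₊ + ζ`:
`Δ(J − E*) ≤ (r² + a²)²(V − ω²) ≤ Δ(J + 3 + E*)`,
`E* = S²/ζ² + 2|S||ω|(1 + (r₊ + r₋)/ζ)`, `S = (r₊² + a²)(ω − mω₊)`. [folklore] -/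
theorem sq_mul_negCoeff_mem_Icc_of_layer (ha : |a| < M) {ζ : ℝ} (hζ : 0 < ζ) {r : ℝ}
    (hr : rPlus M a + ζ ≤ r) :
    delta M a r *
          (Λ - 2 * a * m * ω - ω ^ 2 * (r + rPlus M a) ^ 2 * ((r - rPlus M a) / (r - rMinus M a)) -
            (((rPlus M a ^ 2 + a ^ 2) * (ω - m * horizonAngularVelocity M a)) ^ 2 / ζ ^ 2 +
              2 * |(rPlus M a ^ 2 + a ^ 2) * (ω - m * horizonAngularVelocity M a)| * |ω| *
                (1 + (rPlus M a + rMinus M a) / ζ))) ≤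
        (r ^ 2 + a ^ 2) ^ 2 * (sepPotential M a ω m Λ r - ω ^ 2) ∧
      (r ^ 2 + a ^ 2) ^ 2 * (sepPotential M a ω m Λ r - ω ^ 2) ≤
        delta M a r *
          (Λ - 2 * a * m * ω - ω ^ 2 * (r + rPlus M a) ^ 2 * ((r - rPlus M a) / (r - rMinus M a)) +
            3 + (((rPlus M a ^ 2 + a ^ 2) * (ω - m * horizonAngularVelocity M a)) ^ 2 / ζ ^ 2 +
              2 * |(rPlus M a ^ 2 + a ^ 2) * (ω - m * horizonAngularVelocity M a)| * |ω| *
                (1 + (rPlus M a + rMinus M a) / ζ))) := by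
  have hsub : IsSubextremal M a := ha
  have hM : 0 < M := hsub.pos
  have hrp : 0 < rPlus M a := rPlus_pos hM a
  have hrm0 : 0 ≤ rMinus M a := rMinus_nonneg_of_abs_le ha.le
  have hd : 0 < rPlus M a - rMinus M a := sub_pos.2 hsub.rMinus_lt_rPlus
  have hr' : rPlus M a < r := by linarith
  -- instantiate before abbreviating
  have hid := sq_mul_negCoeff_eq_of_layer (ω := ω) (Λ := Λ) (m := m) ha hr'
  have hW0 : 0 ≤ (r ^ 2 + a ^ 2) ^ 2 * sepPotential₁ M a r :=
    mul_nonneg (sq_nonneg _) (sepPotential₁_nonneg ha.le hr'.le)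
  have hW3 := sq_mul_sepPotential₁_le hM ha.le hr'.le
  have hΔeq : delta M a r = (r - rPlus M a) * (r - rMinus M a) := delta_eq_mul ha.le r
  set S := (rPlus M a ^ 2 + a ^ 2) * (ω - m * horizonAngularVelocity M a) with hS
  set J := Λ - 2 * a * m * ω - ω ^ 2 * (r + rPlus M a) ^ 2 * ((r - rPlus M a) / (r - rMinus M a))
    with hJ
  set W := (r ^ 2 + a ^ 2) ^ 2 * sepPotential₁ M a r with hW
  set X := r - rPlus M a with hX
  set Y := r - rMinus M a with hY
  set Es := S ^ 2 / ζ ^ 2 + 2 * |S| * |ω| * (1 + (rPlus M a + rMinus M a) / ζ) with hEs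
  have hXζ : ζ ≤ X := by rw [hX]; linarith
  have hX0 : 0 < X := hζ.trans_le hXζ
  have hYX : Y = X + (rPlus M a - rMinus M a) := by rw [hY, hX]; ring
  have hY0 : 0 < Y := by rw [hYX]; linarith
  have hYζ : ζ ≤ Y := by rw [hYX]; linarith
  have hΔ0 : 0 < delta M a r := by rw [hΔeq]; positivity
  clear_value S J W
  -- `|E| ≤ Δ E*`
  have hE : |S ^ 2 + 2 * S * (ω * X * (r + rPlus M a))| ≤ delta M a r * Es := by
    rw [hΔeq, hEs]
    refine (abs_add_le _ _).trans ?_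
    rw [abs_of_nonneg (sq_nonneg S)]
    have split : X * Y * (S ^ 2 / ζ ^ 2 + 2 * |S| * |ω| * (1 + (rPlus M a + rMinus M a) / ζ)) =
        X * Y * (S ^ 2 / ζ ^ 2) + X * Y * (2 * |S| * |ω| * (1 + (rPlus M a + rMinus M a) / ζ)) := by ring
    rw [split]
    refine add_le_add ?_ ?_
    · -- `S² ≤ X Y S²/ζ²`
      rw [mul_div_assoc', le_div_iff₀ (by positivity)]
      have : ζ ^ 2 ≤ X * Y := by rw [sq]; exact mul_le_mul hXζ hYζ hζ.le hX0.le
      nlinarith [sq_nonneg S, this]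
    · -- `2|S||ω| X (r + r₊) ≤ X Y · 2|S||ω|(1 + (r₊+r₋)/ζ)` since `r + r₊ = Y + (r₊ + r₋) ≤ Y(1 + (r₊+r₋)/ζ)`
      rw [abs_mul, abs_mul, abs_of_pos (by norm_num : (0:ℝ) < 2), abs_mul, abs_mul, abs_of_pos hX0,
        abs_of_pos (by linarith : 0 < r + rPlus M a)]
      have hsum : r + rPlus M a ≤ Y * (1 + (rPlus M a + rMinus M a) / ζ) := by
        have e : r + rPlus M a = Y + (rPlus M a + rMinus M a) := by rw [hY]; ring
        have h1 : rPlus M a + rMinus M a ≤ Y * ((rPlus M a + rMinus M a) / ζ) := by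
          rw [mul_div_assoc', le_div_iff₀ hζ]
          have := mul_le_mul_of_nonneg_left hYζ (show 0 ≤ rPlus M a + rMinus M a by linarith only [hrm0, hrp])
          linarith only [this]
        have e2 : Y * (1 + (rPlus M a + rMinus M a) / ζ) = Y + Y * ((rPlus M a + rMinus M a) / ζ) := by
          ring
        rw [e, e2]; linarith only [h1]
      have h0 : 0 ≤ 2 * |S| * (|ω| * X) := by positivity
      calc 2 * |S| * (|ω| * X * (r + rPlus M a)) = 2 * |S| * (|ω| * X) * (r + rPlus M a) := by ring
        _ ≤ 2 * |S| * (|ω| * X) * (Y * (1 + (rPlus M a + rMinus M a) / ζ)) :=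
            mul_le_mul_of_nonneg_left hsum h0
        _ = X * Y * (2 * |S| * |ω| * (1 + (rPlus M a + rMinus M a) / ζ)) := by ring
  have hE1 := (abs_le.1 hE).1
  have hE2 := (abs_le.1 hE).2
  have e : ω * (r - rPlus M a) * (r + rPlus M a) = ω * X * (r + rPlus M a) := by rw [hX]
  rw [e] at hid
  have eΔ : delta M a r * (J - Es) = delta M a r * J - delta M a r * Es := by ring
  have eΔ' : delta M a r * (J + 3 + Es) = delta M a r * J + 3 * delta M a r + delta M a r * Es := by ring
  constructor
  · rw [hid, eΔ]; linarith only [hW0, hE2]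
  · rw [hid, eΔ']; linarith only [hW3, hE1]

end LayerRate

end Kerr

end Literature.Geometry.Lorentzian

end
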